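import Mathlib
import HarnessLib
import Summits.HubbardSuperconductivity.HubbardSuperconductivity.Theses.KLProgramme
import Summits.HubbardSuperconductivity.HubbardSuperconductivity.Theorems.KLProgrammeKLRegimeSplitGenericV4
import Summits.HubbardSuperconductivity.HubbardSuperconductivity.Theorems.KLProgrammeKLRegimeSplitSlotsV17F2
import Summits.HubbardSuperconductivity.HubbardSuperconductivity.Theorems.KLProgrammeKLRegimeSplitGlue
import Summits.HubbardSuperconductivity.HubbardSuperconductivity.Theorems.KLProgrammeKLRegimeTwoLegReadJetDefs
import Summits.HubbardSuperconductivity.HubbardSuperconductivity.Theorems.KLProgrammeKLRegimeTwoLegCurvatureConstsJetC2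
import Summits.HubbardSuperconductivity.HubbardSuperconductivity.Theorems.KLProgrammeKLRegimeEngineKernelNormsWt4
import Summits.HubbardSuperconductivity.HubbardSuperconductivity.Theorems.KLProgrammeKLRegimeEngineWtBudget
import Summits.HubbardSuperconductivity.HubbardSuperconductivity.Theorems.KLProgrammeKLRegimeEngineSelfEnergySymmetric
import Summits.HubbardSuperconductivity.HubbardSuperconductivity.Theorems.KLProgrammeKLRegimeEngineV8ExportUnroll
import Summits.HubbardSuperconductivity.HubbardSuperconductivity.Theorems.KLProgrammeKLRegimeEngineV8ExportUnroll2
import Summits.HubbardSuperconductivity.HubbardSuperconductivity.Theorems.KLProgrammeKLRegimeEngineV8ExportUnroll3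
import Summits.HubbardSuperconductivity.HubbardSuperconductivity.Theorems.KLProgrammeKLRegimeEngineV8IsoTupleExportW
import Summits.HubbardSuperconductivity.HubbardSuperconductivity.Theorems.KLProgrammeKLRegimeEngineV8TwoLegMomentsExportGrid
import Summits.HubbardSuperconductivity.HubbardSuperconductivity.Theorems.KLProgrammeKLRegimeEngineV8TwoLegMomentsExportGridC
import Summits.HubbardSuperconductivity.HubbardSuperconductivity.Theorems.KLProgrammeKLRegimeEngineTwoLegStepV17F2ClosersGridBinderCThr
import Summits.HubbardSuperconductivity.HubbardSuperconductivity.Theorems.KLProgrammeKLRegimeEngineV8TowerExports2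
import Summits.HubbardSuperconductivity.HubbardSuperconductivity.Theorems.KLProgrammeKLRegimeEngineV8IsoTupleExport
import Summits.HubbardSuperconductivity.HubbardSuperconductivity.Theorems.KLProgrammeKLRegimeEngineV8PairTransferExport
import Summits.HubbardSuperconductivity.HubbardSuperconductivity.Theorems.KLProgrammeKLRegimeEngineV8PairTransferExport7
import Summits.HubbardSuperconductivity.HubbardSuperconductivity.Theorems.KLProgrammeKLRegimeEngineV8Raise
import Summits.HubbardSuperconductivity.HubbardSuperconductivity.Theorems.KLProgrammeKLRegimeEngineV8RaiseDoors
import Summits.HubbardSuperconductivity.HubbardSuperconductivity.Theorems.KLProgrammeKLRegimeEngineScaleZeroKernelNormsWt4Q7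
import Summits.HubbardSuperconductivity.HubbardSuperconductivity.Theorems.KLProgrammeKLRegimeEngineV8DefsG8
import Summits.HubbardSuperconductivity.HubbardSuperconductivity.Theorems.KLProgrammeKLRegimeEngineV8DefsQ8
import Summits.HubbardSuperconductivity.HubbardSuperconductivity.Theorems.KLProgrammeKLRegimeEngineV8DefsU10
import Summits.HubbardSuperconductivity.HubbardSuperconductivity.Theorems.KLProgrammeKLRegimeEngineV8DefsL4
import Summits.HubbardSuperconductivity.HubbardSuperconductivity.Theorems.KLProgrammeKLRegimeSplitFlowPieceMeanOsc
import Summits.HubbardSuperconductivity.HubbardSuperconductivity.Theorems.KLProgrammeKLRegimeSplitFlowPieceOscDefs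
import Summits.HubbardSuperconductivity.HubbardSuperconductivity.Theorems.KLProgrammeKLRegimeTwoLegReadOscConsts
import Summits.HubbardSuperconductivity.HubbardSuperconductivity.Theorems.KLProgrammeKLRegimeEngineV8DefsQ9c
import Summits.HubbardSuperconductivity.HubbardSuperconductivity.Theorems.KLProgrammeKLRegimeEngineScaleZeroV17FRaise
import Summits.HubbardSuperconductivity.HubbardSuperconductivity.Theorems.KLProgrammeKLRegimeEngineTwoLegStepV17F2ZeroCloserRaise
import Summits.HubbardSuperconductivity.HubbardSuperconductivity.Theorems.KLProgrammeKLRegimeSplitGeoShellLog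
import Summits.HubbardSuperconductivity.HubbardSuperconductivity.Theorems.KLProgrammeKLRegimeEngineV8DefsGeo9
import Summits.HubbardSuperconductivity.HubbardSuperconductivity.Theorems.KLProgrammeKLRegimeEngineV8DefsG10
import Summits.HubbardSuperconductivity.HubbardSuperconductivity.Theorems.KLProgrammeKLRegimeEngineV8IsoMomentRowClosers
import Summits.HubbardSuperconductivity.HubbardSuperconductivity.Theorems.KLProgrammeKLRegimeEngineV8DefsG11Hosting
import Summits.HubbardSuperconductivity.HubbardSuperconductivity.Theorems.KLProgrammeKLRegimeEngineV8TwoLegSpaceMomentsExport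
import Summits.HubbardSuperconductivity.HubbardSuperconductivity.Theorems.KLProgrammeKLRegimeEngineV8DefsU12b
import Summits.HubbardSuperconductivity.HubbardSuperconductivity.Theorems.KLProgrammeKLRegimeEngineV8GridLiteralsPkg
import Summits.HubbardSuperconductivity.HubbardSuperconductivity.Theorems.KLProgrammeKLRegimeEngineV8DefsU12bG
import Summits.HubbardSuperconductivity.HubbardSuperconductivity.Theorems.KLProgrammeKLRegimeEngineV8DefsG14
import Summits.HubbardSuperconductivity.HubbardSuperconductivity.Theorems.KLProgrammeKLRegimeEngineV8DefsQ9dG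
import Summits.HubbardSuperconductivity.HubbardSuperconductivity.Theorems.KLProgrammeKLRegimeEngineV8DefsU12bGQ
import Summits.HubbardSuperconductivity.HubbardSuperconductivity.Theorems.KLProgrammeKLRegimeEngineV8PairTransferExport8
import Summits.HubbardSuperconductivity.HubbardSuperconductivity.Theorems.KLProgrammeKLRegimeEngineV8TwoLegSpaceMomentsExportZ
import Summits.HubbardSuperconductivity.HubbardSuperconductivity.Theorems.KLProgrammeKLRegimeEngineV17F2ClosersGQ

/-!
# Route `KLProgramme` — ENGINE item stmt-HubbardSuperconductivity-20437 `KLRegimeEngineV17F2`: THE REGISTERED COMPOSITION §C OF THE IMAGE OF RECORD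
# r16 V2 (α1) «A24∪A25∪Z∪α1»-G14 (`engine-flow-v2x.r16-A24A25Za1-G14.lean`, sha256 27cd7ed0f55f17c0…, `payload.skeleton` ts 2026-08-29T08:47:19Z)
# AS ONE SORRY-FREE THEOREM: the crux BY NAME from its five ACTIVE registered rows (C)(X)(b)(c)(e) taken as HYPOTHESES
# (cell gate-hubbard-kl, registrant seat gate-hubbard-kl-p1b g18)

WHAT.  The registered skeleton proves `…Theses.KLProgramme.KLRegimeEngineV17F2` from seven open stub rows by the composition §C (`engine_slots_of_stubs_v2x`,
`flowPieceOsc_hist_of_stubs_v2x`, `engineP4_klPredsV17F2_of_stubs_v2x`, `KLRegimeEngineV17F2_of`); rows (a) `stub_engine_scale0` and (M) `stub_twoLeg_scale0` are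
LANDED (`…EngineV8.A24a1G14.stub_engine_scale0` / `.stub_twoLeg_scale0`, module `…EngineV17F2ClosersGQ`, p710057).  This file is §C VERBATIM with the two landed
rows consumed BY NAME and the five ACTIVE rows — (C) `stub_twoLeg_curvature` 7138417578ff, (X) `stub_engine_exports` b5ef244eede8, (b) `stub_engine_step_norms`
e78dfb33d2f7, (c) `stub_engine_step_values` f2bba37a7dce, (e) `stub_twoLeg_step` d9e0dae239cf (J-convention sha12 of the registered texts) — turned into the explicit
hypotheses `rowC rowX rowB rowV rowE` whose types are those registered texts VERBATIM (whitespace-reflowed; same sha12 after whitespace collapse):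

* `engine_slots_of_rows` — §C's `engine_slots_of_stubs_v2x` (public slots at one scale: exports unrolled from (X), `n = 0` from (a)(C)(M), `n ≥ 1` from (b) → (c) → (C)
  → (e), the (R59w) bootstrap `hboot` by strong induction on the scale over all comparison volumes);
* `flowPieceOsc_hist_of_rows` — §C's export `flowPieceOsc_hist_of_stubs_v2x` (the (K5′) mean-free piece history below any scale, from (X).3 and (C) only; the VL item
  stmt-HubbardSuperconductivity-23356 reads it);
* **`KLRegimeEngineV17F2_of_rows`** — the crux BY NAME from the five rows (§C's `engineP4_klPredsV17F2_of_stubs_v2x` ∘ `KLRegimeEngineV17F2_of`), with the registered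
  witnesses `klEngGeo14`, `klEngQ9dG klEngGeo14 P R` (#13), `klEngC₃7GU klEngGeo14 P R` (#28), `klEngU₀12GQ klEngGeo14 (klEngQ9dG klEngGeo14 P R) P R c` (#14), `klEngL₄ P R`, `klEngM₃`.

WHY (registrant bookkeeping; pen rulings (R330)/(R394)(E)/(R407)).  (i) The composition of record now lives IN THE TREE under build protection instead of only in a
session file; (ii) the day the five rows are theorems the crux closes by ONE application `KLRegimeEngineV17F2_of_rows rowC rowX rowB rowV rowE` (the closers-modulo-
producers of record instantiate three of them: (b) `A24a1G14.stub_engine_step_norms_of_producers hexT hexI hexG` (p710057), (C) `A24a1G14.stub_twoLeg_curvature_of_producers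
hexZ hcertA hres` (p709580), (c) `A24a1G14.stub_engine_step_values_of_producers hexLad hexOut hexIso` (p711453); (X) is the producers' three ∃-rows; (e) the p609934-family
closer modulo the VL lane's (e)-D-ROWS); (iii) the five hypothesis texts are the registry's digest inputs, so a reader re-derives the five sha12 above from THIS file.

Pure composition of landed theorems (no definition, no instance, no notation); CONDITIONAL: the five rows are HYPOTHESES and are NOT asserted; nothing here asserts
(C), (X), (b), (c), (e), any producer, K3, the Kohn–Luttinger margin or superconductivity in the Hubbard model.  0 kit · 0 lit.
References: BGM 2006 §2.4 (2.36), §3 Thm 3.1 (the multiscale engine this composition organises) [cite: BenfattoGiulianiMastropietro2006].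
-/

noncomputable section

namespace Summit.HubbardSuperconductivity.HubbardSuperconductivity.Theorems.EngineV8.R16V2Rows

set_option linter.dupNamespace false -- summit = problem name (single-conjunct summit), D-0017

open Real Finset Filter Literature.MathematicalPhysics.QuantumLattice Literature.Probability.LatticeModels
open Literature.MathematicalPhysics.QuantumLattice.FermiRG
open Summit.HubbardSuperconductivity.HubbardSuperconductivity.Theorems.KLProgrammeLegKernels
open Summit.HubbardSuperconductivity.HubbardSuperconductivity.Theorems.DispersionFlow
open Summit.HubbardSuperconductivity.HubbardSuperconductivity.Theorems.KLRegimeSplit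

/-! # §C COMPOSITION (K2) of the registered image — the class unrolls carry the export induction; ONE strong induction on the scale = the (R59w) bootstrap `hboot` -/

section Composition

/-- **The public slots at one scale from the five registered rows (C)(X)(b)(c)(e) as hypotheses and the landed rows (a)/(M)** (§C `engine_slots_of_stubs_v2x` of the
image 27cd7ed0f55f17c0 verbatim): for `n ≤ n_β + 1` in the regime with the public history below `n`, the engine bounds and the two-leg
step at `n`.  Exports at every `j ≤ n` UNROLLED from (X) (class #1 first, then #6/#5 fed with it); `n = 0` from (a)(C)(M); `n ≥ 1` from (b) → (c) → (C) → (e), the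
grid binder of (e) fed by the (R59w) BOOTSTRAP `hboot` (comparison history ⇒ public history ⇒ grid atom, at every comparison volume and every scale `≤ n`). -/
theorem engine_slots_of_rows
    (rowC :
      ∀ (P : SplitConsts) (R : RenConsts) (c : ℝ), P.WF → R.WF2 → 0 < c → c ≤ klEngC₃7GU klEngGeo14 P R →
      ∀ μ ∈ klWindowC, ∀ U : ℝ, 0 < U → U ≤ klEngU₀12GQ klEngGeo14 (klEngQ9dG klEngGeo14 P R) P R c → ∀ β : ℝ, klBetaMin ≤ β → β ≤ Real.exp (c / U ^ 2) →
      ∀ (L M : ℕ) [NeZero L] [NeZero M], klEngL₄ P R β U ≤ L → klEngM₃ β U L ≤ M → ∀ n : ℕ, n ≤ nScales β + 1 → IsKLRegime U c (-(n : ℤ)) →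
      HistP klPredsV17F2 L M klEngGeo14 P (klEngQ9dG klEngGeo14 P R) R β U μ 0 n → FrameOK R U (nScales β) μ (klFlowFrameU L M β U μ n) →
      EngineBoundsAtV17F2 L M klEngGeo14 P (klEngQ9dG klEngGeo14 P R) β U μ n → TwoLegDualSpaceMomentsUpToAt L M (klZsp5AtZ P R (klEngQ7 P R) klEngGeo14 U n) β U μ n 5 →
      TwoLegReadJetBound L M klC4aJetC2 (klC4aJetC' P R) β U μ (klFlowFrameU L M β U μ n) n ∧ TwoLegReadOscAt L M (klReadOscC P R) β U μ (klFlowFrameU L M β U μ n) n)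
    (rowX :
      ∀ (P : SplitConsts) (R : RenConsts), P.WF → R.WF2 → (∃ e : (ℕ → ℝ) × ℝ × (EngConsts → ℝ → ℝ), IsExportPkg2 e ∧ LevelsUStep2 P R (klEngQ7 P R) e.1 e.2.2) ∧
      (∃ e : ℝ × (EngConsts → ℝ → ℝ), IsTransferPkg8 e ∧ PairTransferStep7 P R (klEngQ7 P R) klEngGeo14 klEngGeoTh e.1 e.2) ∧
      (∃ e : (ℕ → ℝ) × (EngConsts → ℝ → ℝ), IsSpaceMomPkg5Z R e ∧ TwoLegSpaceMomentsStep5 P R (klEngQ7 P R) klEngGeo14 e.1 e.2))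
    (rowB :
      ∀ (P : SplitConsts) (R : RenConsts) (c : ℝ), P.WF → R.WF2 → 0 < c → c ≤ klEngC₃7GU klEngGeo14 P R →
      ∀ μ ∈ klWindowC, ∀ U : ℝ, 0 < U → U ≤ klEngU₀12GQ klEngGeo14 (klEngQ9dG klEngGeo14 P R) P R c → ∀ β : ℝ, klBetaMin ≤ β → β ≤ Real.exp (c / U ^ 2) →
      ∀ (L M : ℕ) [NeZero L] [NeZero M], klEngL₄ P R β U ≤ L → klEngM₃ β U L ≤ M → ∀ n : ℕ, 1 ≤ n → n ≤ nScales β + 1 → IsKLRegime U c (-(n : ℤ)) →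
      HistP klPredsV17F2 L M klEngGeo14 P (klEngQ9dG klEngGeo14 P R) R β U μ 0 n → (∀ m, 1 ≤ m → m < n → FlowPieceOscAt L M (klReadOscC P R) β U μ m) →
      FrameOK R U (nScales β) μ (klFlowFrameU L M β U μ n) → (∀ j ≤ n, LevelsUExportMixedAt L M (klCU2 P R (klEngQ7 P R)) P β U μ j) →
      KernelNormsV4 L M P (klEngQ9dG klEngGeo14 P R) β U μ (klFlowFrameU L M β U μ n) n ∧
      (∀ j ≤ n, (KernelNormsLevels L M P (klEngQ9dG klEngGeo14 P R) β U μ (klFlowFrameU L M β U μ n) j ∧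
      KernelNormsWt4 L M (klWtBudget P (klEngQ9dG klEngGeo14 P R) U j) β U μ (klFlowFrameU L M β U μ n) j)) ∧
      EngineFirstMoments L M klEngGeo14 P (klEngQ9dG klEngGeo14 P R) β U μ (klFlowFrameU L M β U μ n) n ∧ IsoFirstMomentsAt L M klIsoMomC (klIsoMomD P R) P β U μ n ∧
      TwoLegGridFlowMomentsAtC L M (klZtG klEngGeo14 P R) (klZs1G klEngGeo14 P R) (klZs2G klEngGeo14 P R) c β U μ n)
    (rowV :
      ∀ (P : SplitConsts) (R : RenConsts) (c : ℝ), P.WF → R.WF2 → 0 < c → c ≤ klEngC₃7GU klEngGeo14 P R →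
      ∀ μ ∈ klWindowC, ∀ U : ℝ, 0 < U → U ≤ klEngU₀12GQ klEngGeo14 (klEngQ9dG klEngGeo14 P R) P R c → ∀ β : ℝ, klBetaMin ≤ β → β ≤ Real.exp (c / U ^ 2) →
      ∀ (L M : ℕ) [NeZero L] [NeZero M], klEngL₄ P R β U ≤ L → klEngM₃ β U L ≤ M → ∀ n : ℕ, 1 ≤ n → n ≤ nScales β + 1 → IsKLRegime U c (-(n : ℤ)) →
      HistP klPredsV17F2 L M klEngGeo14 P (klEngQ9dG klEngGeo14 P R) R β U μ 0 n → FrameOK R U (nScales β) μ (klFlowFrameU L M β U μ n) →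
      KernelNormsV4 L M P (klEngQ9dG klEngGeo14 P R) β U μ (klFlowFrameU L M β U μ n) n →
      (∀ j ≤ n, (KernelNormsLevels L M P (klEngQ9dG klEngGeo14 P R) β U μ (klFlowFrameU L M β U μ n) j ∧
      KernelNormsWt4 L M (klWtBudget P (klEngQ9dG klEngGeo14 P R) U j) β U μ (klFlowFrameU L M β U μ n) j)) →
      (∀ j ≤ n, LevelsUExportMixedAt L M (klCU2 P R (klEngQ7 P R)) P β U μ j) → (∀ j ≤ n, IsoTupleLineBAt L M klE5AM klE5cM (klE5dM P R) P β U μ j) →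
      (∀ j ≤ n, PairTransferRelFamilyK5 L M klEngGeoTh P (klCT8 P R (klEngQ7 P R) klEngGeo14 klEngGeoTh) β U μ j) →
      PairLadderStepAtV17F2 L M klEngGeo14 P (klEngQ9dG klEngGeo14 P R) β U μ n ∧ PairValueIncrementAtV17F L M klEngGeo14 P (klEngQ9dG klEngGeo14 P R) β U μ n ∧
      QuarticValueIncrementAtV17F L M klEngGeo14 P (klEngQ9dG klEngGeo14 P R) β U μ n ∧ IsoTupleL1AtV17F L M klEngGeo14 P β U μ n)
    (rowE :
      ∀ (P : SplitConsts) (R : RenConsts) (c : ℝ), P.WF → R.WF2 → 0 < c → c ≤ klEngC₃7GU klEngGeo14 P R →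
      ∀ μ ∈ klWindowC, ∀ U : ℝ, 0 < U → U ≤ klEngU₀12GQ klEngGeo14 (klEngQ9dG klEngGeo14 P R) P R c → ∀ β : ℝ, klBetaMin ≤ β → β ≤ Real.exp (c / U ^ 2) →
      ∀ (L M : ℕ) [NeZero L] [NeZero M], klEngL₄ P R β U ≤ L → klEngM₃ β U L ≤ M → ∀ n : ℕ, 1 ≤ n → n ≤ nScales β + 1 → IsKLRegime U c (-(n : ℤ)) →
      HistP klPredsV17F2 L M klEngGeo14 P (klEngQ9dG klEngGeo14 P R) R β U μ 0 n → FrameOK R U (nScales β) μ (klFlowFrameU L M β U μ n) →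
      EngineBoundsAtV17F2 L M klEngGeo14 P (klEngQ9dG klEngGeo14 P R) β U μ n → TwoLegReadJetBound L M klC4aJetC2 (klC4aJetC' P R) β U μ (klFlowFrameU L M β U μ n) n →
      (∀ j ≤ n, (KernelNormsLevels L M P (klEngQ9dG klEngGeo14 P R) β U μ (klFlowFrameU L M β U μ n) j ∧
      KernelNormsWt4 L M (klWtBudget P (klEngQ9dG klEngGeo14 P R) U j) β U μ (klFlowFrameU L M β U μ n) j)) →
      (∀ j ≤ n, LevelsUExportMixedAt L M (klCU2 P R (klEngQ7 P R)) P β U μ j) →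
      (∀ n' ≤ n, ∀ (L₁ M₁ : ℕ) [NeZero L₁] [NeZero M₁], L ≤ L₁ → (klEngQ9dG klEngGeo14 P R).M0 β L₁ ≤ M₁ →
      (∀ j < n', histV17F2 L₁ M₁ klEngGeo14 P (klEngQ9dG klEngGeo14 P R) R β U μ j ∧ TwoLegSlopes L₁ M₁ R β U μ (klFlowFrameU L₁ M₁ β U μ j) j) →
      TwoLegGridMomentsAtC L₁ M₁ (klZtG klEngGeo14 P R) (klZs1G klEngGeo14 P R) (klZs2G klEngGeo14 P R) c β U μ (klFlowFrameU L₁ M₁ β U μ n') n') →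
      TwoLegStepV17F2 L M klEngGeo14 P (klEngQ9dG klEngGeo14 P R) R β U μ n)
    (P : SplitConsts) (R : RenConsts) (c : ℝ) (hP : P.WF) (hR : R.WF2) (hc : 0 < c) (hc3 : c ≤ klEngC₃7GU klEngGeo14 P R)
    (μ : ℝ) (hμ : μ ∈ klWindowC) (U : ℝ) (hU : 0 < U) (hUle : U ≤ klEngU₀12GQ klEngGeo14 (klEngQ9dG klEngGeo14 P R) P R c) (β : ℝ) (hβ : klBetaMin ≤ β) (hβc : β ≤ Real.exp (c / U ^ 2))
    (L M : ℕ) [NeZero L] [NeZero M] (hL : klEngL₄ P R β U ≤ L) (hM : klEngM₃ β U L ≤ M) {n : ℕ} (hn : n ≤ nScales β + 1)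
    (hreg : IsKLRegime U c (-(n : ℤ))) (hhist : HistP klPredsV17F2 L M klEngGeo14 P (klEngQ9dG klEngGeo14 P R) R β U μ 0 n) :
    EngineBoundsAtV17F2 L M klEngGeo14 P (klEngQ9dG klEngGeo14 P R) β U μ n ∧ TwoLegStepV17F2 L M klEngGeo14 P (klEngQ9dG klEngGeo14 P R) R β U μ n := by
  have h0 : FrameOK R U (nScales β) μ 0 := klFrameOK_zeroC hR.wf U (nScales β) hμ
  have hc36 : c ≤ klEngC₃6 P R := hc3.trans (klEngC₃7GU_le_klEngC₃6 klEngGeo14 P R)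
  have hfr : FrameOK R U (nScales β) μ (klFlowFrameU L M β U μ n) := frameOK_klFlowFrameU_of_histP hR h0 hn hhist
  have hsym : SelfEnergySymmetric L M β U μ (klFlowFrameU L M β U μ n) n := selfEnergySymmetric_all L M β U μ (klFlowFrameU L M β U μ n) n
  -- the unrolled exports (K2 order: class #1 first; #5 fed with it; #6 interleaved with (b) per (R59e)(ii))
  obtain ⟨h1, h5, hm5⟩ := rowX P R hP hR
  have hU10 : U ≤ klEngU₀10 P R c := hUle.trans (klEngU₀12GQ_le_klEngU₀10 klEngGeo14 (klEngQ9dG klEngGeo14 P R) P R c)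
  have hlevU : ∀ j ≤ n, LevelsUExportMixedAt L M (klCU2 P R (klEngQ7 P R)) P β U μ j :=
    levelsUExportMixedAt_klCU2_all_of_exists h1 klEngGeo14_wf (isRaiseOf_klEngQ9dG klEngGeo14 P R) hc hc36 hμ h0 hU hU10
      (hUle.trans (klEngU₀12GQ_le_klCUu2 klEngGeo14 (klEngQ9dG klEngGeo14 P R) P R c)) hβ hβc hL hM hR hn hhist
  -- «M5» (pen (R85a)(B)/(R136)): (C)'s order-≤5 space-moment binder at ANY volume/scale from (X).3 through the producer's unroll closer,
  -- which reads the export HISTORY below the scale ⇒ STRONG INDUCTION on the scale at fixed volume (history/frame/engine slot at j < n' from `HistP … n'`)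
  have hm5I : ∀ n', ∀ (L' M' : ℕ) [NeZero L'] [NeZero M'], klEngL₄ P R β U ≤ L' → klEngM₃ β U L' ≤ M' → n' ≤ nScales β + 1 →
      HistP klPredsV17F2 L' M' klEngGeo14 P (klEngQ9dG klEngGeo14 P R) R β U μ 0 n' → FrameOK R U (nScales β) μ (klFlowFrameU L' M' β U μ n') →
        EngineBoundsAtV17F2 L' M' klEngGeo14 P (klEngQ9dG klEngGeo14 P R) β U μ n' → TwoLegDualSpaceMomentsUpToAt L' M' (klZsp5AtZ P R (klEngQ7 P R) klEngGeo14 U n') β U μ n' 5 := by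
    intro n'
    induction n' using Nat.strong_induction_on with
    | _ n' ih =>
      intro L' M' _ _ hL' hM' hn' hh' hfr' hE'
      have hhistM5 : ∀ j < n', TwoLegDualSpaceMomentsUpToAt L' M' (klZsp5AtZ P R (klEngQ7 P R) klEngGeo14 U j) β U μ j 5 := fun j hj =>
        ih j hj L' M' hL' hM' ((le_of_lt hj).trans hn') (histP_klPredsV17F2_of_le hh' hj.le)
          (frameOK_klFlowFrameU_of_histP hR h0 ((le_of_lt hj).trans hn') (histP_klPredsV17F2_of_le hh' hj.le))
          ((histP_klPredsV17F2_iff L' M' klEngGeo14 P (klEngQ9dG klEngGeo14 P R) R β U μ 0 n').1 hh' j hj).2.2.1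
      exact twoLegDualSpaceMomentsUpToAt_all_of_existsZ hm5 (isRaiseOf_klEngQ9dG klEngGeo14 P R) hc hc36 hμ hU hU10 (hUle.trans (klEngU₀12GQ_le_klZspU5Z klEngGeo14 (klEngQ9dG klEngGeo14 P R) P R c)) hβ hβc hL' hM' hn' hh' hfr' hE' hhistM5
  have hm5V : ∀ (L' M' : ℕ) [NeZero L'] [NeZero M'], klEngL₄ P R β U ≤ L' → klEngM₃ β U L' ≤ M' → ∀ n' ≤ nScales β + 1,
      HistP klPredsV17F2 L' M' klEngGeo14 P (klEngQ9dG klEngGeo14 P R) R β U μ 0 n' → FrameOK R U (nScales β) μ (klFlowFrameU L' M' β U μ n') →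
        EngineBoundsAtV17F2 L' M' klEngGeo14 P (klEngQ9dG klEngGeo14 P R) β U μ n' → TwoLegDualSpaceMomentsUpToAt L' M' (klZsp5AtZ P R (klEngQ7 P R) klEngGeo14 U n') β U μ n' 5 :=
    fun L' M' _ _ hL' hM' n' hn' hh' hfr' hE' => hm5I n' L' M' hL' hM' hn' hh' hfr' hE'
  -- (K5′) THE MEAN-FREE PIECE DATA BELOW ANY SCALE, AT ANY VOLUME, from (C)ₘ's new conjunct through the bridge (same constant c₀″; ContDiff from the two-leg slot of `HistP`)
  have hoscV : ∀ (L' M' : ℕ) [NeZero L'] [NeZero M'], klEngL₄ P R β U ≤ L' → klEngM₃ β U L' ≤ M' → ∀ k ≤ nScales β + 1,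
      HistP klPredsV17F2 L' M' klEngGeo14 P (klEngQ9dG klEngGeo14 P R) R β U μ 0 k → ∀ m, 1 ≤ m → m < k → FlowPieceOscAt L' M' (klReadOscC P R) β U μ m := by
    intro L' M' _ _ hL' hM' k hk hh m _hm1 hmk
    have hmk' : m ≤ nScales β + 1 := (le_of_lt hmk).trans hk
    have hhm : HistP klPredsV17F2 L' M' klEngGeo14 P (klEngQ9dG klEngGeo14 P R) R β U μ 0 m := histP_klPredsV17F2_of_le hh hmk.le
    have hslot := (histP_klPredsV17F2_iff L' M' klEngGeo14 P (klEngQ9dG klEngGeo14 P R) R β U μ 0 k).1 hh m hmk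
    have hfrm : FrameOK R U (nScales β) μ (klFlowFrameU L' M' β U μ m) := frameOK_klFlowFrameU_of_histP hR h0 hmk' hhm
    have hC := rowC P R c hP hR hc hc3 μ hμ U hU hUle β hβ hβc L' M' hL' hM' m hmk'
      (isKLRegime_of_le_nScales_succ hc.le hβ hβc hmk') hhm hfrm hslot.2.2.1 (hm5V L' M' hL' hM' m hmk' hhm hfrm hslot.2.2.1)
    exact flowPieceOscAt_of_readOscAt hμ hslot.2.2.2.1.1 hC.2
  -- «G10-MOM» INTERLEAVE (pen (R89)): the class-#6 lines at the EXPLICIT constants at every j ≤ n in ONE call, fed per scale 1 ≤ m ≤ n with (b)ₘ's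
  -- `IsoFirstMomentsAt` row (conjunct 4); the scale-0 line is inside the closer (`isoTupleLineBAt_klE5M_zero`)
  have hβ0 : 0 ≤ β := (lt_of_lt_of_le (by norm_num [klBetaMin]) hβ).le
  have hiso : ∀ j ≤ n, IsoTupleLineBAt L M klE5AM klE5cM (klE5dM P R) P β U μ j :=
    isoTupleLineBAt_klE5M_all_of_frame hP hR hc hc36 hμ h0 hU hU10 hβ hβc hL hM hn hhist
      (fun m hm1 hmn hhm hfrm =>
        (rowB P R c hP hR hc hc3 μ hμ U hU hUle β hβ hβc L M hL hM m hm1 (hmn.trans hn)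
          (isKLRegime_of_le_nScales_succ hc.le hβ hβc (hmn.trans hn)) hhm (hoscV L M hL hM m (hmn.trans hn) hhm) hfrm
          (fun j hj => hlevU j (hj.trans hmn))).2.2.2.1)
  have htr : ∀ j ≤ n, PairTransferRelFamilyK5 L M klEngGeoTh P (klCT8 P R (klEngQ7 P R) klEngGeo14 klEngGeoTh) β U μ j :=
    pairTransferRelFamilyK5_klCT8_all_of_exists_T h5 klEngGeo14_wf (isRaiseOf_klEngQ9dG klEngGeo14 P R) hc hc36 hμ h0 hU hU10
      (hUle.trans (klEngU₀12GQ_le_klCTu8T klEngGeo14 (klEngQ9dG klEngGeo14 P R) P R c)) hβ hβc hL hM hR hn hhist hlevU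
  -- (R59w) THE BOOTSTRAP.  At every scale `m ≤ n_β + 1` and every comparison volume `(L₁, M₁)` above `(L; Q.M0)`: the COMPARISON history below `m`
  -- (`histV17F2 ∧ TwoLegSlopes`, = the antecedent currency of `TwoLegVolumeRateF`, which lacks the volume-rate conjuncts) UPGRADES to the PUBLIC history
  -- `HistP … 0 m` (the missing two-leg slots at `i < m` are (M) (i = 0) / (e)ᵢ (i ≥ 1) AT THAT VOLUME, whose own grid binders are the bootstrap at the
  -- scales `≤ i < m` — strong induction), AND the grid atom at `m` holds there ((b)ₘ's 4th conjunct at that volume, its class-#1 input unrolled from (X).1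
  -- against that volume's public history; the scale-0 theorem at `m = 0`, door U₀10 ≤ U₀9, budgets klE3A1 ≤ klE3Acum).
  have hboot : ∀ m, m ≤ nScales β + 1 → ∀ (L₁ M₁ : ℕ) [NeZero L₁] [NeZero M₁], L ≤ L₁ → (klEngQ9dG klEngGeo14 P R).M0 β L₁ ≤ M₁ →
      (∀ j < m, histV17F2 L₁ M₁ klEngGeo14 P (klEngQ9dG klEngGeo14 P R) R β U μ j ∧ TwoLegSlopes L₁ M₁ R β U μ (klFlowFrameU L₁ M₁ β U μ j) j) →
        HistP klPredsV17F2 L₁ M₁ klEngGeo14 P (klEngQ9dG klEngGeo14 P R) R β U μ 0 m ∧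
          TwoLegGridMomentsAtC L₁ M₁ (klZtG klEngGeo14 P R) (klZs1G klEngGeo14 P R) (klZs2G klEngGeo14 P R) c β U μ (klFlowFrameU L₁ M₁ β U μ m) m := by
    intro m
    induction m using Nat.strong_induction_on with
    | _ m ih =>
      intro hm L₁ M₁ _ _ hLL₁ hM₁ hCH
      have hL₁ : klEngL₄ P R β U ≤ L₁ := hL.trans hLL₁
      have hM₁' : klEngM₃ β U L₁ ≤ M₁ := by
        have e : (klEngQ9dG klEngGeo14 P R).M0 β L₁ = 2 ^ 10 * (⌈|β|⌉₊ + 1) ^ 2 * (L₁ + 1) ^ 2 := rfl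
        rw [e] at hM₁; exact hM₁
      -- (i) the public history below m at (L₁, M₁)
      have hhist₁ : HistP klPredsV17F2 L₁ M₁ klEngGeo14 P (klEngQ9dG klEngGeo14 P R) R β U μ 0 m := by
        rw [histP_klPredsV17F2_iff]
        intro i hi
        obtain ⟨hSi, hRi, hEi, -⟩ := (hCH i hi).1
        refine ⟨hSi, hRi, hEi, ?_⟩
        have him : i ≤ nScales β + 1 := (le_of_lt hi).trans hm
        have hCHi : ∀ j < i, histV17F2 L₁ M₁ klEngGeo14 P (klEngQ9dG klEngGeo14 P R) R β U μ j ∧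
            TwoLegSlopes L₁ M₁ R β U μ (klFlowFrameU L₁ M₁ β U μ j) j := fun j hj => hCH j (hj.trans hi)
        have hhistI : HistP klPredsV17F2 L₁ M₁ klEngGeo14 P (klEngQ9dG klEngGeo14 P R) R β U μ 0 i := (ih i hi him L₁ M₁ hLL₁ hM₁ hCHi).1
        have hfrI : FrameOK R U (nScales β) μ (klFlowFrameU L₁ M₁ β U μ i) := frameOK_klFlowFrameU_of_histP hR h0 him hhistI
        have hregI : IsKLRegime U c (-(i : ℤ)) := isKLRegime_of_le_nScales_succ hc.le hβ hβc him
        have hJI := (rowC P R c hP hR hc hc3 μ hμ U hU hUle β hβ hβc L₁ M₁ hL₁ hM₁' i him hregI hhistI hfrI hEi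
          (hm5V L₁ M₁ hL₁ hM₁' i him hhistI hfrI hEi)).1
        rcases Nat.eq_zero_or_pos i with rfl | hi1
        · exact A24a1G14.stub_twoLeg_scale0 P R c hP hR hc hc3 μ hμ U hU hUle β hβ hβc L₁ M₁ hL₁ hM₁' hfrI hEi hJI
        · have hlevUI : ∀ j ≤ i, LevelsUExportMixedAt L₁ M₁ (klCU2 P R (klEngQ7 P R)) P β U μ j :=
            levelsUExportMixedAt_klCU2_all_of_exists h1 klEngGeo14_wf (isRaiseOf_klEngQ9dG klEngGeo14 P R) hc hc36 hμ h0 hU hU10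
              (hUle.trans (klEngU₀12GQ_le_klCUu2 klEngGeo14 (klEngQ9dG klEngGeo14 P R) P R c)) hβ hβc hL₁ hM₁' hR him hhistI
          obtain ⟨-, hlevI, -, -⟩ :=
            rowB P R c hP hR hc hc3 μ hμ U hU hUle β hβ hβc L₁ M₁ hL₁ hM₁' i hi1 him hregI hhistI (hoscV L₁ M₁ hL₁ hM₁' i him hhistI) hfrI hlevUI
          exact rowE P R c hP hR hc hc3 μ hμ U hU hUle β hβ hβc L₁ M₁ hL₁ hM₁' i hi1 him hregI hhistI hfrI hEi hJI hlevI hlevUI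
            (fun i' hi' L₂ M₂ _ _ hL₁L₂ hM₂ hCH₂ => (ih i' (lt_of_le_of_lt hi' hi) (hi'.trans him) L₂ M₂ (hLL₁.trans hL₁L₂) hM₂ hCH₂).2)
      refine ⟨hhist₁, ?_⟩
      -- (ii) the grid atom at (L₁, M₁, m)
      rcases Nat.eq_zero_or_pos m with rfl | hm1
      · exact (twoLegGridFlowMomentsAtC_iff _ _ _ c β U μ 0).1
          ((twoLegGridFlowMomentsAtC_zero_klE3A1 P hR hμ hU (hU10.trans (klEngU₀10_le_klEngU₀9 P R c)) hβ
            (klEngL₃_le_of_klEngL₄_le hL₁) hM₁').mono hβ0 hc.le (klZtG_base klEngGeo14 P R) (klZs1G_nonneg klEngGeo14 P R) (klZs2G_base klEngGeo14 P R))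
      · have hfr₁ : FrameOK R U (nScales β) μ (klFlowFrameU L₁ M₁ β U μ m) := frameOK_klFlowFrameU_of_histP hR h0 hm hhist₁
        have hlevU₁ : ∀ j ≤ m, LevelsUExportMixedAt L₁ M₁ (klCU2 P R (klEngQ7 P R)) P β U μ j :=
          levelsUExportMixedAt_klCU2_all_of_exists h1 klEngGeo14_wf (isRaiseOf_klEngQ9dG klEngGeo14 P R) hc hc36 hμ h0 hU hU10
            (hUle.trans (klEngU₀12GQ_le_klCUu2 klEngGeo14 (klEngQ9dG klEngGeo14 P R) P R c)) hβ hβc hL₁ hM₁' hR hm hhist₁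
        exact (twoLegGridFlowMomentsAtC_iff _ _ _ c β U μ m).1
          (rowB P R c hP hR hc hc3 μ hμ U hU hUle β hβ hβc L₁ M₁ hL₁ hM₁' m hm1 hm
            (isKLRegime_of_le_nScales_succ hc.le hβ hβc hm) hhist₁ (hoscV L₁ M₁ hL₁ hM₁' m hm hhist₁) hfr₁ hlevU₁).2.2.2.2
  rcases Nat.eq_zero_or_pos n with rfl | hn1
  · -- n = 0: (a), (C), (M)
    obtain ⟨hN, h2, h5', h6', h7⟩ := A24a1G14.stub_engine_scale0 P R c hP hR hc hc3 μ hμ U hU hUle β hβ hβc L M hL hM hfr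
    have hE : EngineBoundsAtV17F2 L M klEngGeo14 P (klEngQ9dG klEngGeo14 P R) β U μ 0 :=
      ⟨hsym, hN, h2, fun h => absurd h (by norm_num), fun h => absurd h (by norm_num), h5', h6', h7⟩
    have hJ := (rowC P R c hP hR hc hc3 μ hμ U hU hUle β hβ hβc L M hL hM 0 hn hreg hhist hfr hE (hm5V L M hL hM 0 hn hhist hfr hE)).1
    exact ⟨hE, A24a1G14.stub_twoLeg_scale0 P R c hP hR hc hc3 μ hμ U hU hUle β hβ hβc L M hL hM hfr hE hJ⟩
  · -- n ≥ 1: (b) → (c) → (C) → (e), pure consumers of the unrolled exports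
    obtain ⟨hN, hlev, h6', -⟩ :=
      rowB P R c hP hR hc hc3 μ hμ U hU hUle β hβ hβc L M hL hM n hn1 hn hreg hhist (hoscV L M hL hM n hn hhist) hfr hlevU
    obtain ⟨h2, h3, h4, h7⟩ :=
      rowV P R c hP hR hc hc3 μ hμ U hU hUle β hβ hβc L M hL hM n hn1 hn hreg hhist hfr hN hlev hlevU hiso htr
    have hE : EngineBoundsAtV17F2 L M klEngGeo14 P (klEngQ9dG klEngGeo14 P R) β U μ n :=
      ⟨hsym, hN, h2, h3, h4, fun h0' => absurd h0' (by omega), h6', h7⟩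
    have hJ := (rowC P R c hP hR hc hc3 μ hμ U hU hUle β hβ hβc L M hL hM n hn hreg hhist hfr hE (hm5V L M hL hM n hn hhist hfr hE)).1
    -- (e)ₙ at (L, M), its grid binder = the bootstrap's second half at every scale n' ≤ n
    exact ⟨hE, rowE P R c hP hR hc hc3 μ hμ U hU hUle β hβ hβc L M hL hM n hn1 hn hreg hhist hfr hE hJ hlev hlevU
      (fun n' hn' L₁ M₁ _ _ hLL₁ hM₁ hCH => (hboot n' (hn'.trans hn) L₁ M₁ hLL₁ hM₁ hCH).2)⟩

/-- **§C EXPORT of the image (pen (R296)) from rows (X) and (C) as hypotheses**: the (K5′) MEAN-FREE PIECE HISTORY below any scale `k ≤ n_β + 1`,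
at any volume above the engine thresholds, FROM THE STUBS — exactly `engine_slots_of_stubs_v2x`'s internal `hoscV` (per scale `m < k`: the `HistP` slot ⇒
`EngineBoundsAtV17F2 … m`; the (X) space-moment export unrolled by strong induction (`hm5I`) ⇒ (C)ₘ `stub_twoLeg_curvature … m` ⇒ its LAST conjunct
`TwoLegReadOscAt … (klReadOscC P R) … (K_m) m` ⇒ the bridge `flowPieceOscAt_of_readOscAt`, same constant), lifted out of §C so that the VL item
(stmt-HubbardSuperconductivity-23356) can discharge its atom HOsc′ from the ENGINE (p2 g25's `hoscAtom_of_children`).  Sorry-free composition; nothing new is asserted. -/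
theorem flowPieceOsc_hist_of_rows
    (rowC :
      ∀ (P : SplitConsts) (R : RenConsts) (c : ℝ), P.WF → R.WF2 → 0 < c → c ≤ klEngC₃7GU klEngGeo14 P R →
      ∀ μ ∈ klWindowC, ∀ U : ℝ, 0 < U → U ≤ klEngU₀12GQ klEngGeo14 (klEngQ9dG klEngGeo14 P R) P R c → ∀ β : ℝ, klBetaMin ≤ β → β ≤ Real.exp (c / U ^ 2) →
      ∀ (L M : ℕ) [NeZero L] [NeZero M], klEngL₄ P R β U ≤ L → klEngM₃ β U L ≤ M → ∀ n : ℕ, n ≤ nScales β + 1 → IsKLRegime U c (-(n : ℤ)) →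
      HistP klPredsV17F2 L M klEngGeo14 P (klEngQ9dG klEngGeo14 P R) R β U μ 0 n → FrameOK R U (nScales β) μ (klFlowFrameU L M β U μ n) →
      EngineBoundsAtV17F2 L M klEngGeo14 P (klEngQ9dG klEngGeo14 P R) β U μ n → TwoLegDualSpaceMomentsUpToAt L M (klZsp5AtZ P R (klEngQ7 P R) klEngGeo14 U n) β U μ n 5 →
      TwoLegReadJetBound L M klC4aJetC2 (klC4aJetC' P R) β U μ (klFlowFrameU L M β U μ n) n ∧ TwoLegReadOscAt L M (klReadOscC P R) β U μ (klFlowFrameU L M β U μ n) n)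
    (rowX :
      ∀ (P : SplitConsts) (R : RenConsts), P.WF → R.WF2 → (∃ e : (ℕ → ℝ) × ℝ × (EngConsts → ℝ → ℝ), IsExportPkg2 e ∧ LevelsUStep2 P R (klEngQ7 P R) e.1 e.2.2) ∧
      (∃ e : ℝ × (EngConsts → ℝ → ℝ), IsTransferPkg8 e ∧ PairTransferStep7 P R (klEngQ7 P R) klEngGeo14 klEngGeoTh e.1 e.2) ∧
      (∃ e : (ℕ → ℝ) × (EngConsts → ℝ → ℝ), IsSpaceMomPkg5Z R e ∧ TwoLegSpaceMomentsStep5 P R (klEngQ7 P R) klEngGeo14 e.1 e.2))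
    (P : SplitConsts) (R : RenConsts) (c : ℝ) (hP : P.WF) (hR : R.WF2) (hc : 0 < c) (hc3 : c ≤ klEngC₃7GU klEngGeo14 P R)
    (μ : ℝ) (hμ : μ ∈ klWindowC) (U : ℝ) (hU : 0 < U) (hUle : U ≤ klEngU₀12GQ klEngGeo14 (klEngQ9dG klEngGeo14 P R) P R c) (β : ℝ) (hβ : klBetaMin ≤ β) (hβc : β ≤ Real.exp (c / U ^ 2))
    (L M : ℕ) [NeZero L] [NeZero M] (hL : klEngL₄ P R β U ≤ L) (hM : klEngM₃ β U L ≤ M) {k : ℕ} (hk : k ≤ nScales β + 1)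
    (hhist : HistP klPredsV17F2 L M klEngGeo14 P (klEngQ9dG klEngGeo14 P R) R β U μ 0 k) :
    ∀ m, 1 ≤ m → m < k → FlowPieceOscAt L M (klReadOscC P R) β U μ m := by
  have h0 : FrameOK R U (nScales β) μ 0 := klFrameOK_zeroC hR.wf U (nScales β) hμ
  have hc36 : c ≤ klEngC₃6 P R := hc3.trans (klEngC₃7GU_le_klEngC₃6 klEngGeo14 P R)
  obtain ⟨-, -, hm5⟩ := rowX P R hP hR
  have hU10 : U ≤ klEngU₀10 P R c := hUle.trans (klEngU₀12GQ_le_klEngU₀10 klEngGeo14 (klEngQ9dG klEngGeo14 P R) P R c)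
  have hm5I : ∀ n', ∀ (L' M' : ℕ) [NeZero L'] [NeZero M'], klEngL₄ P R β U ≤ L' → klEngM₃ β U L' ≤ M' → n' ≤ nScales β + 1 →
      HistP klPredsV17F2 L' M' klEngGeo14 P (klEngQ9dG klEngGeo14 P R) R β U μ 0 n' → FrameOK R U (nScales β) μ (klFlowFrameU L' M' β U μ n') →
        EngineBoundsAtV17F2 L' M' klEngGeo14 P (klEngQ9dG klEngGeo14 P R) β U μ n' → TwoLegDualSpaceMomentsUpToAt L' M' (klZsp5AtZ P R (klEngQ7 P R) klEngGeo14 U n') β U μ n' 5 := by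
    intro n'
    induction n' using Nat.strong_induction_on with
    | _ n' ih =>
      intro L' M' _ _ hL' hM' hn' hh' hfr' hE'
      have hhistM5 : ∀ j < n', TwoLegDualSpaceMomentsUpToAt L' M' (klZsp5AtZ P R (klEngQ7 P R) klEngGeo14 U j) β U μ j 5 := fun j hj =>
        ih j hj L' M' hL' hM' ((le_of_lt hj).trans hn') (histP_klPredsV17F2_of_le hh' hj.le)
          (frameOK_klFlowFrameU_of_histP hR h0 ((le_of_lt hj).trans hn') (histP_klPredsV17F2_of_le hh' hj.le))
          ((histP_klPredsV17F2_iff L' M' klEngGeo14 P (klEngQ9dG klEngGeo14 P R) R β U μ 0 n').1 hh' j hj).2.2.1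
      exact twoLegDualSpaceMomentsUpToAt_all_of_existsZ hm5 (isRaiseOf_klEngQ9dG klEngGeo14 P R) hc hc36 hμ hU hU10 (hUle.trans (klEngU₀12GQ_le_klZspU5Z klEngGeo14 (klEngQ9dG klEngGeo14 P R) P R c)) hβ hβc hL' hM' hn' hh' hfr' hE' hhistM5
  have hm5V : ∀ (L' M' : ℕ) [NeZero L'] [NeZero M'], klEngL₄ P R β U ≤ L' → klEngM₃ β U L' ≤ M' → ∀ n' ≤ nScales β + 1,
      HistP klPredsV17F2 L' M' klEngGeo14 P (klEngQ9dG klEngGeo14 P R) R β U μ 0 n' → FrameOK R U (nScales β) μ (klFlowFrameU L' M' β U μ n') →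
        EngineBoundsAtV17F2 L' M' klEngGeo14 P (klEngQ9dG klEngGeo14 P R) β U μ n' → TwoLegDualSpaceMomentsUpToAt L' M' (klZsp5AtZ P R (klEngQ7 P R) klEngGeo14 U n') β U μ n' 5 :=
    fun L' M' _ _ hL' hM' n' hn' hh' hfr' hE' => hm5I n' L' M' hL' hM' hn' hh' hfr' hE'
  -- (K5′) THE MEAN-FREE PIECE DATA BELOW ANY SCALE, AT ANY VOLUME, from (C)ₘ's new conjunct through the bridge (same constant c₀″; ContDiff from the two-leg slot of `HistP`)
  have hoscV : ∀ (L' M' : ℕ) [NeZero L'] [NeZero M'], klEngL₄ P R β U ≤ L' → klEngM₃ β U L' ≤ M' → ∀ k ≤ nScales β + 1,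
      HistP klPredsV17F2 L' M' klEngGeo14 P (klEngQ9dG klEngGeo14 P R) R β U μ 0 k → ∀ m, 1 ≤ m → m < k → FlowPieceOscAt L' M' (klReadOscC P R) β U μ m := by
    intro L' M' _ _ hL' hM' k hk hh m _hm1 hmk
    have hmk' : m ≤ nScales β + 1 := (le_of_lt hmk).trans hk
    have hhm : HistP klPredsV17F2 L' M' klEngGeo14 P (klEngQ9dG klEngGeo14 P R) R β U μ 0 m := histP_klPredsV17F2_of_le hh hmk.le
    have hslot := (histP_klPredsV17F2_iff L' M' klEngGeo14 P (klEngQ9dG klEngGeo14 P R) R β U μ 0 k).1 hh m hmk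
    have hfrm : FrameOK R U (nScales β) μ (klFlowFrameU L' M' β U μ m) := frameOK_klFlowFrameU_of_histP hR h0 hmk' hhm
    have hC := rowC P R c hP hR hc hc3 μ hμ U hU hUle β hβ hβc L' M' hL' hM' m hmk'
      (isKLRegime_of_le_nScales_succ hc.le hβ hβc hmk') hhm hfrm hslot.2.2.1 (hm5V L' M' hL' hM' m hmk' hhm hfrm hslot.2.2.1)
    exact flowPieceOscAt_of_readOscAt hμ hslot.2.2.2.1.1 hC.2
  exact hoscV L M hL hM k hk hhist

end Composition

/-- **`KLRegimeEngineV17F2_of_rows`** — ENGINE item stmt-HubbardSuperconductivity-20437 BY NAME from its five ACTIVE registered rows (C)(X)(b)(c)(e) as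
hypotheses (types = the registered texts, sha12 7138417578ff / b5ef244eede8 / e78dfb33d2f7 / f2bba37a7dce / d9e0dae239cf) and the landed rows (a)/(M): §C's
`engineP4_klPredsV17F2_of_stubs_v2x` (witnesses `klEngGeo14`, `klEngQ9dG klEngGeo14 P R`, `klEngC₃7GU`, `klEngU₀12GQ`, `klEngL₄`, `klEngM₃`) ∘ `KLRegimeEngineV17F2_of`.
CONDITIONAL: nothing asserts the rows. -/
theorem KLRegimeEngineV17F2_of_rows
    (rowC :
      ∀ (P : SplitConsts) (R : RenConsts) (c : ℝ), P.WF → R.WF2 → 0 < c → c ≤ klEngC₃7GU klEngGeo14 P R →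
      ∀ μ ∈ klWindowC, ∀ U : ℝ, 0 < U → U ≤ klEngU₀12GQ klEngGeo14 (klEngQ9dG klEngGeo14 P R) P R c → ∀ β : ℝ, klBetaMin ≤ β → β ≤ Real.exp (c / U ^ 2) →
      ∀ (L M : ℕ) [NeZero L] [NeZero M], klEngL₄ P R β U ≤ L → klEngM₃ β U L ≤ M → ∀ n : ℕ, n ≤ nScales β + 1 → IsKLRegime U c (-(n : ℤ)) →
      HistP klPredsV17F2 L M klEngGeo14 P (klEngQ9dG klEngGeo14 P R) R β U μ 0 n → FrameOK R U (nScales β) μ (klFlowFrameU L M β U μ n) →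
      EngineBoundsAtV17F2 L M klEngGeo14 P (klEngQ9dG klEngGeo14 P R) β U μ n → TwoLegDualSpaceMomentsUpToAt L M (klZsp5AtZ P R (klEngQ7 P R) klEngGeo14 U n) β U μ n 5 →
      TwoLegReadJetBound L M klC4aJetC2 (klC4aJetC' P R) β U μ (klFlowFrameU L M β U μ n) n ∧ TwoLegReadOscAt L M (klReadOscC P R) β U μ (klFlowFrameU L M β U μ n) n)
    (rowX :
      ∀ (P : SplitConsts) (R : RenConsts), P.WF → R.WF2 → (∃ e : (ℕ → ℝ) × ℝ × (EngConsts → ℝ → ℝ), IsExportPkg2 e ∧ LevelsUStep2 P R (klEngQ7 P R) e.1 e.2.2) ∧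
      (∃ e : ℝ × (EngConsts → ℝ → ℝ), IsTransferPkg8 e ∧ PairTransferStep7 P R (klEngQ7 P R) klEngGeo14 klEngGeoTh e.1 e.2) ∧
      (∃ e : (ℕ → ℝ) × (EngConsts → ℝ → ℝ), IsSpaceMomPkg5Z R e ∧ TwoLegSpaceMomentsStep5 P R (klEngQ7 P R) klEngGeo14 e.1 e.2))
    (rowB :
      ∀ (P : SplitConsts) (R : RenConsts) (c : ℝ), P.WF → R.WF2 → 0 < c → c ≤ klEngC₃7GU klEngGeo14 P R →
      ∀ μ ∈ klWindowC, ∀ U : ℝ, 0 < U → U ≤ klEngU₀12GQ klEngGeo14 (klEngQ9dG klEngGeo14 P R) P R c → ∀ β : ℝ, klBetaMin ≤ β → β ≤ Real.exp (c / U ^ 2) →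
      ∀ (L M : ℕ) [NeZero L] [NeZero M], klEngL₄ P R β U ≤ L → klEngM₃ β U L ≤ M → ∀ n : ℕ, 1 ≤ n → n ≤ nScales β + 1 → IsKLRegime U c (-(n : ℤ)) →
      HistP klPredsV17F2 L M klEngGeo14 P (klEngQ9dG klEngGeo14 P R) R β U μ 0 n → (∀ m, 1 ≤ m → m < n → FlowPieceOscAt L M (klReadOscC P R) β U μ m) →
      FrameOK R U (nScales β) μ (klFlowFrameU L M β U μ n) → (∀ j ≤ n, LevelsUExportMixedAt L M (klCU2 P R (klEngQ7 P R)) P β U μ j) →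
      KernelNormsV4 L M P (klEngQ9dG klEngGeo14 P R) β U μ (klFlowFrameU L M β U μ n) n ∧
      (∀ j ≤ n, (KernelNormsLevels L M P (klEngQ9dG klEngGeo14 P R) β U μ (klFlowFrameU L M β U μ n) j ∧
      KernelNormsWt4 L M (klWtBudget P (klEngQ9dG klEngGeo14 P R) U j) β U μ (klFlowFrameU L M β U μ n) j)) ∧
      EngineFirstMoments L M klEngGeo14 P (klEngQ9dG klEngGeo14 P R) β U μ (klFlowFrameU L M β U μ n) n ∧ IsoFirstMomentsAt L M klIsoMomC (klIsoMomD P R) P β U μ n ∧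
      TwoLegGridFlowMomentsAtC L M (klZtG klEngGeo14 P R) (klZs1G klEngGeo14 P R) (klZs2G klEngGeo14 P R) c β U μ n)
    (rowV :
      ∀ (P : SplitConsts) (R : RenConsts) (c : ℝ), P.WF → R.WF2 → 0 < c → c ≤ klEngC₃7GU klEngGeo14 P R →
      ∀ μ ∈ klWindowC, ∀ U : ℝ, 0 < U → U ≤ klEngU₀12GQ klEngGeo14 (klEngQ9dG klEngGeo14 P R) P R c → ∀ β : ℝ, klBetaMin ≤ β → β ≤ Real.exp (c / U ^ 2) →
      ∀ (L M : ℕ) [NeZero L] [NeZero M], klEngL₄ P R β U ≤ L → klEngM₃ β U L ≤ M → ∀ n : ℕ, 1 ≤ n → n ≤ nScales β + 1 → IsKLRegime U c (-(n : ℤ)) →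
      HistP klPredsV17F2 L M klEngGeo14 P (klEngQ9dG klEngGeo14 P R) R β U μ 0 n → FrameOK R U (nScales β) μ (klFlowFrameU L M β U μ n) →
      KernelNormsV4 L M P (klEngQ9dG klEngGeo14 P R) β U μ (klFlowFrameU L M β U μ n) n →
      (∀ j ≤ n, (KernelNormsLevels L M P (klEngQ9dG klEngGeo14 P R) β U μ (klFlowFrameU L M β U μ n) j ∧
      KernelNormsWt4 L M (klWtBudget P (klEngQ9dG klEngGeo14 P R) U j) β U μ (klFlowFrameU L M β U μ n) j)) →
      (∀ j ≤ n, LevelsUExportMixedAt L M (klCU2 P R (klEngQ7 P R)) P β U μ j) → (∀ j ≤ n, IsoTupleLineBAt L M klE5AM klE5cM (klE5dM P R) P β U μ j) →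
      (∀ j ≤ n, PairTransferRelFamilyK5 L M klEngGeoTh P (klCT8 P R (klEngQ7 P R) klEngGeo14 klEngGeoTh) β U μ j) →
      PairLadderStepAtV17F2 L M klEngGeo14 P (klEngQ9dG klEngGeo14 P R) β U μ n ∧ PairValueIncrementAtV17F L M klEngGeo14 P (klEngQ9dG klEngGeo14 P R) β U μ n ∧
      QuarticValueIncrementAtV17F L M klEngGeo14 P (klEngQ9dG klEngGeo14 P R) β U μ n ∧ IsoTupleL1AtV17F L M klEngGeo14 P β U μ n)
    (rowE :
      ∀ (P : SplitConsts) (R : RenConsts) (c : ℝ), P.WF → R.WF2 → 0 < c → c ≤ klEngC₃7GU klEngGeo14 P R →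
      ∀ μ ∈ klWindowC, ∀ U : ℝ, 0 < U → U ≤ klEngU₀12GQ klEngGeo14 (klEngQ9dG klEngGeo14 P R) P R c → ∀ β : ℝ, klBetaMin ≤ β → β ≤ Real.exp (c / U ^ 2) →
      ∀ (L M : ℕ) [NeZero L] [NeZero M], klEngL₄ P R β U ≤ L → klEngM₃ β U L ≤ M → ∀ n : ℕ, 1 ≤ n → n ≤ nScales β + 1 → IsKLRegime U c (-(n : ℤ)) →
      HistP klPredsV17F2 L M klEngGeo14 P (klEngQ9dG klEngGeo14 P R) R β U μ 0 n → FrameOK R U (nScales β) μ (klFlowFrameU L M β U μ n) →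
      EngineBoundsAtV17F2 L M klEngGeo14 P (klEngQ9dG klEngGeo14 P R) β U μ n → TwoLegReadJetBound L M klC4aJetC2 (klC4aJetC' P R) β U μ (klFlowFrameU L M β U μ n) n →
      (∀ j ≤ n, (KernelNormsLevels L M P (klEngQ9dG klEngGeo14 P R) β U μ (klFlowFrameU L M β U μ n) j ∧
      KernelNormsWt4 L M (klWtBudget P (klEngQ9dG klEngGeo14 P R) U j) β U μ (klFlowFrameU L M β U μ n) j)) →
      (∀ j ≤ n, LevelsUExportMixedAt L M (klCU2 P R (klEngQ7 P R)) P β U μ j) →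
      (∀ n' ≤ n, ∀ (L₁ M₁ : ℕ) [NeZero L₁] [NeZero M₁], L ≤ L₁ → (klEngQ9dG klEngGeo14 P R).M0 β L₁ ≤ M₁ →
      (∀ j < n', histV17F2 L₁ M₁ klEngGeo14 P (klEngQ9dG klEngGeo14 P R) R β U μ j ∧ TwoLegSlopes L₁ M₁ R β U μ (klFlowFrameU L₁ M₁ β U μ j) j) →
      TwoLegGridMomentsAtC L₁ M₁ (klZtG klEngGeo14 P R) (klZs1G klEngGeo14 P R) (klZs2G klEngGeo14 P R) c β U μ (klFlowFrameU L₁ M₁ β U μ n') n') →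
      TwoLegStepV17F2 L M klEngGeo14 P (klEngQ9dG klEngGeo14 P R) R β U μ n) :
    Summit.HubbardSuperconductivity.HubbardSuperconductivity.Theses.KLProgramme.KLRegimeEngineV17F2 := by
  unfold Summit.HubbardSuperconductivity.HubbardSuperconductivity.Theses.KLProgramme.KLRegimeEngineV17F2
  refine ⟨klEngGeo14, klEngGeo14_wf, fun P hP R hR => ⟨klEngQ9dG klEngGeo14 P R, klEngQ9dG_wf klEngGeo14 P R, klEngC₃7GU klEngGeo14 P R, klEngC₃7GU_pos klEngGeo14 P hR, fun c hc hc3 => ?_⟩⟩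
  refine ⟨klEngU₀12GQ klEngGeo14 (klEngQ9dG klEngGeo14 P R) P R c, klEngU₀12GQ_pos (klEngQ9dG klEngGeo14 P R) P c klEngGeo14_wf hP hR (klEngQ9dG_CR_nonneg klEngGeo14 P R), klEngL₄ P R, klEngM₃, ?_⟩
  intro μ hμ U hU hUle β hβ hβc K hK L M _ _ hL hM n hn hreg hhist
  obtain ⟨rfl, -⟩ := (klPredsV17F2_frameOK_iff R U (nScales β) μ K).1 hK
  exact engine_slots_of_rows rowC rowX rowB rowV rowE P R c hP hR hc hc3 μ hμ U hU hUle β hβ hβc L M hL hM hn hreg hhist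

end Summit.HubbardSuperconductivity.HubbardSuperconductivity.Theorems.EngineV8.R16V2Rows

end
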